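/-
Copyright (c) 2026 the pub-hodgecm-mathlib formalisation cell (harness21).  Prover seat hodgecm-mathlib-K2Liu-p13 (g0), Track B «K2-LIT»,
#184♮ = hLiu418 = `stmt-HodgeConjecture-24832`; #42S payer road, organ S1 (census `K2/K2Liu-p13/g0/CENSUS-42S-PayerRoad.K2Liu-p13-g0.md` 835e26ef3967b414,
file S1-F1; LEAD F0P6-plan (g13) ORDER 08:56:51Z).
-/
import Summits.HodgeConjecture.HodgeConjecture.Theorems.K2LiuLocalSWSectionDefs   -- ★ D-A v1 (K2Liu-p09): `swSectionLoc`, `swSectionTensorLoc`, `tensorEmbLoc`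
import Literature.NumberTheory.K2Lit.LocalDoublingSiegel                           -- ★ D7a: the K2Lit δ-package, `localDegPS` read for the doubled datum
import HarnessLib

/-!
# Crux `HLiu418`, #42S payer road, organ S1, file S1-F1: THE LOCAL SIEGEL–WEIL IMAGE `R_n(V′_v) ≤ (H_v → ℂ)` AS A SUBSPACE
# (the carrier of «`I_v(½, χ_v) = R₂(V⁺_v) + R₂(V⁻_v)`», of U1's kernel statements and of the #42S generators, place by place)

Cell `hodgecm-mathlib`, crux item hLiu418 = `stmt-HodgeConjecture-24832`; squad K2 ∕ K2Liu; LEAD F0P6-plan (g13), co-dealer K2E5-plan (g6); prover K2Liu-p13 (g0).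
DEFINITIONS WITH BODIES + their algebra (review lane `--kind definition`, `--supports stmt-HodgeConjecture-24832 --as helper`); no instance, no notation,
no named-fact hypothesis, no `sorry`.

SETTING = ★ D-A v1 `K2LiuLocalSWSectionDefs` verbatim: the doubled CM datum `(L, e, dV, dW)` (group `H_v = U(𝔻)(L⁺_v)`, `𝔻 = 𝕍 ⊕ −𝕍`), a diagonal hermitian frame
`dV′ : Fin M₂ → L` for the auxiliary space `V′` with tensor frames `(eW, e′)` (★ `tensorFrame`), a finite place `v` of `L⁺`, and a LOCAL doubled Weil datum `(sB, m₀)` of the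
big group `U(𝔻 ⊗ V′)(L⁺_v)` on the Schrödinger model `𝒮(L⁺_v^{n′+n′})` (generic, as in D-A; Kudla's datum is an instance).  The local hermitian space `V′_v` of the print is
`V′ ⊗ L⁺_v`; BOTH local isomorphism classes `V^±_v` of a given dimension arise from global diagonal frames `dV′` (prescribe the norm class of the discriminant at `v`),
so one carrier indexed by `dV′` serves `R₂(V⁺_v)` and `R₂(V⁻_v)`.

* §1 `swSectionTensorLocLinear` — `Φ ↦ F_Φ := swSectionTensorLoc … v sB m₀ Φ` as a `ℂ`-LINEAR map `𝒮(L⁺_v^{n′+n′}) →ₗ[ℂ] (H_v → ℂ)` (★ `swSectionTensorLoc_add∕_smul`).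
* §2 **`localSWImage … v sB m₀ : Submodule ℂ (H_v → ℂ)`** := its range — the print's `R_n(V′_v) = im(Φ ↦ F_Φ)` [GanQiuTakeda2014 §5.4 `Φ^{n,r}`, Prop. 11; KudlaSweet1997];
  `mem_localSWImage_iff` (`f ∈ R ↔ ∃ Φ, F_Φ = f`), `swSectionTensorLoc_mem_localSWImage`.
* §3 **`H_v`-STABILITY**: `f ∈ R ⇒ (h ↦ f (h k)) ∈ R` for every `k ∈ H_v` (★ `swSectionTensorLoc_mul_right`: `F_Φ(h k) = F_{ω(sB(k ⊗ 1))Φ}(h)`) — `R` is an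
  `H_v`-submodule of the smooth functions; and the finite-sum form `comb_mem_localSWImage`.
* §4 DOCKING: **`localSWImage_le_localDegPS`** — `R ≤ I_v(s, χ_v)` (★ `localDegPS`) as soon as every `F_Φ` is a local Siegel section of parameter `s` and smooth (the two
  inputs BY VALUE; for Kudla's datum at `s = (M₂ − n)∕2` they are ★ `apply_zero_toRep_mul_localSplitting_eq_mul` read through (A-int)'s model files).
What is NOT here (the S1 organ proper, XL, planner-designed): `R ≤ localDegPS χ_v ½` for KUDLA's datum (the Siegel law ★ `apply_zero_toRep_mul_localSplitting_eq_mul` read through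
★ D-A′'s doubling-polarised model — (A-int)'s files), and the SPANNING THEOREM «every smooth section of `I_v(½, χ_v)` lies in `localSWImage(V⁺) ⊔ localSWImage(V⁻)`»
[KudlaSweet1997 Thm 1.2] = [GanQiuTakeda2014 Prop. 11, `s_{3,2} = ½ > 0`].  Consumers: S1 (spanning face), S3 `K2LiuKFiniteSectionPlaceDecomposition`, S5∕U1 (kernel and image of
`M*_v(½)` on `R`), #42S's generator bookkeeping.
[GanQiuTakeda2014, §5.4–5.5 Prop. 11], [KudlaSweet1997, §1], [KudlaRallis1994, §1], [HarrisKudlaSweet1996, §1 (1.8), (1.15)–(1.16)].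
HONEST LABEL.  Carriers only, count-neutral: `HC_CM` is proved only modulo the 7 printed citations (2 remaining named inputs: hLiu418 = `stmt-HodgeConjecture-24832`,
h413 = `stmt-HodgeConjecture-24833`) until rung 0 closes.
-/

set_option autoImplicit false
set_option linter.dupNamespace false -- the mandated namespace repeats `HodgeConjecture.HodgeConjecture`

noncomputable section

open scoped Matrix
open NumberField IsDedekindDomain
open Literature.NumberTheory.Automorphic
open Literature.NumberTheory.GelbartRogawski1991 Literature.NumberTheory.GelbartRogawski1991.GRConstruction
open Literature.NumberTheory.GelbartRogawski1991.UnitaryDualPair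
open Literature.NumberTheory.GelbartRogawski1991.UnitaryDualPair.LocalSplitting
open Literature.NumberTheory.K2Lit.SiegelDoubled
open Literature.RepresentationTheory.HeisenbergGroup
open Literature.NumberTheory.K2Lit.LocalSiegelDoubled
open Summit.HodgeConjecture.HodgeConjecture.Cruxes.HLiu418.K2LiuLocalSWSectionDefs

namespace Summit.HodgeConjecture.HodgeConjecture.Cruxes.HLiu418.K2LiuLocalSWImageDefs

variable (L : Type) [Field L] [NumberField L] [IsCMField L]
variable {N M n : ℕ} (e : Fin N × Fin M ≃ Fin n)
  (dV : Fin N → L) (hdV : ∀ i, IsCMField.complexConj L (dV i) = dV i)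
  (dW : Fin M → L) (hdW : ∀ i, IsCMField.complexConj L (dW i) = dW i)
variable {M₂ M' n' : ℕ} (eW : Fin M × Fin M₂ ≃ Fin M') (e' : Fin N × Fin M' ≃ Fin n')
  (dV' : Fin M₂ → L) (hdV' : ∀ k, IsCMField.complexConj L (dV' k) = dV' k)
variable {T : Matrix (Fin (n' + n')) (Fin (n' + n')) (Fp L)}
variable (v : HeightOneSpectrum (𝓞 (Fp L)))
  (sB : UnitaryGroup.localPi L (IsCMField.complexConj L) (n' + n')
      (hermD L e' dV hdV (tensorFrame L dW eW dV') (tensorFrame_real L dW hdW eW dV' hdV')) v →* LocalMp (Fp L) (n' + n') T v)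
  (m₀ : LocalMp (Fp L) (n' + n') T v)

/-! ## §1 `Φ ↦ F_Φ` as a linear map -/

/-- **`Φ ↦ F_Φ = swSectionTensorLoc … Φ` as a `ℂ`-linear map** `𝒮(L⁺_v^{n′+n′}) →ₗ[ℂ] (H_v → ℂ)` (★ `swSectionTensorLoc_add`, `swSectionTensorLoc_smul`).
[cite: GanQiuTakeda2014, §5.4] [cite: KudlaRallis1994, §1] -/
def swSectionTensorLocLinear :
    SchwartzBruhat (Fin (n' + n') → v.adicCompletion (Fp L)) →ₗ[ℂ]
      (UnitaryGroup.localPi L (IsCMField.complexConj L) (n + n) (hermD L e dV hdV dW hdW) v → ℂ) where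
  toFun Φ := swSectionTensorLoc L e dV hdV dW hdW eW e' dV' hdV' v sB m₀ Φ
  map_add' Φ Ψ := funext fun h => swSectionTensorLoc_add L e dV hdV dW hdW eW e' dV' hdV' v sB m₀ Φ Ψ h
  map_smul' a Φ := funext fun h => by
    rw [RingHom.id_apply, Pi.smul_apply, smul_eq_mul]
    exact swSectionTensorLoc_smul L e dV hdV dW hdW eW e' dV' hdV' v sB m₀ a Φ h

/-- unfolding. [cite: GanQiuTakeda2014, §5.4] -/
@[simp] theorem swSectionTensorLocLinear_apply (Φ : SchwartzBruhat (Fin (n' + n') → v.adicCompletion (Fp L))) :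
    swSectionTensorLocLinear L e dV hdV dW hdW eW e' dV' hdV' v sB m₀ Φ = swSectionTensorLoc L e dV hdV dW hdW eW e' dV' hdV' v sB m₀ Φ :=
  rfl

/-! ## §2 The local Siegel–Weil image `R_n(V′_v)` -/

/-- **THE LOCAL SIEGEL–WEIL IMAGE `R_n(V′_v) ≤ (H_v → ℂ)`**: the range of `Φ ↦ F_Φ` — the print's `R_n(V′_v) = im Φ^{n,r}_v` for the local hermitian space
`V′_v = V′ ⊗ L⁺_v` of the frame `dV′` and the local doubled Weil datum `(sB, m₀)`. [cite: GanQiuTakeda2014, §5.4–5.5 Prop. 11] [cite: KudlaSweet1997, §1]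
[cite: KudlaRallis1994, §1] -/
def localSWImage : Submodule ℂ (UnitaryGroup.localPi L (IsCMField.complexConj L) (n + n) (hermD L e dV hdV dW hdW) v → ℂ) :=
  LinearMap.range (swSectionTensorLocLinear L e dV hdV dW hdW eW e' dV' hdV' v sB m₀)

/-- membership: `f ∈ R_n(V′_v) ↔ ∃ Φ, F_Φ = f`. [cite: GanQiuTakeda2014, §5.4] -/
theorem mem_localSWImage_iff (f : UnitaryGroup.localPi L (IsCMField.complexConj L) (n + n) (hermD L e dV hdV dW hdW) v → ℂ) :
    f ∈ localSWImage L e dV hdV dW hdW eW e' dV' hdV' v sB m₀ ↔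
      ∃ Φ : SchwartzBruhat (Fin (n' + n') → v.adicCompletion (Fp L)), swSectionTensorLoc L e dV hdV dW hdW eW e' dV' hdV' v sB m₀ Φ = f :=
  LinearMap.mem_range

/-- every Siegel–Weil section `F_Φ` lies in `R_n(V′_v)`. [cite: GanQiuTakeda2014, §5.4] -/
theorem swSectionTensorLoc_mem_localSWImage (Φ : SchwartzBruhat (Fin (n' + n') → v.adicCompletion (Fp L))) :
    swSectionTensorLoc L e dV hdV dW hdW eW e' dV' hdV' v sB m₀ Φ ∈ localSWImage L e dV hdV dW hdW eW e' dV' hdV' v sB m₀ :=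
  ⟨Φ, rfl⟩

/-- finite combinations of Siegel–Weil sections lie in `R_n(V′_v)` (it is a subspace). [cite: GanQiuTakeda2014, §5.4] -/
theorem comb_mem_localSWImage {ι : Type*} (s : Finset ι) (c : ι → ℂ) (Φ : ι → SchwartzBruhat (Fin (n' + n') → v.adicCompletion (Fp L))) :
    (∑ i ∈ s, c i • swSectionTensorLoc L e dV hdV dW hdW eW e' dV' hdV' v sB m₀ (Φ i)) ∈ localSWImage L e dV hdV dW hdW eW e' dV' hdV' v sB m₀ :=
  Submodule.sum_mem _ fun i _ => Submodule.smul_mem _ _ (swSectionTensorLoc_mem_localSWImage L e dV hdV dW hdW eW e' dV' hdV' v sB m₀ (Φ i))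

/-! ## §3 `R_n(V′_v)` is stable under right translation by `H_v` -/

/-- **`R_n(V′_v)` IS AN `H_v`-SUBMODULE**: if `f ∈ R_n(V′_v)` then `h ↦ f (h k)` lies in `R_n(V′_v)` for every `k ∈ H_v` (`F_Φ(h k) = F_{ω(sB(k ⊗ 1)) Φ}(h)`,
★ `swSectionTensorLoc_mul_right`). [cite: GanQiuTakeda2014, §5.4] [cite: HarrisKudlaSweet1996, §1 (1.8)] -/
theorem rightTranslate_mem_localSWImage {f : UnitaryGroup.localPi L (IsCMField.complexConj L) (n + n) (hermD L e dV hdV dW hdW) v → ℂ}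
    (hf : f ∈ localSWImage L e dV hdV dW hdW eW e' dV' hdV' v sB m₀)
    (k : UnitaryGroup.localPi L (IsCMField.complexConj L) (n + n) (hermD L e dV hdV dW hdW) v) :
    (fun h => f (h * k)) ∈ localSWImage L e dV hdV dW hdW eW e' dV' hdV' v sB m₀ := by
  obtain ⟨Φ, rfl⟩ := (mem_localSWImage_iff L e dV hdV dW hdW eW e' dV' hdV' v sB m₀ f).1 hf
  refine (mem_localSWImage_iff L e dV hdV dW hdW eW e' dV' hdV' v sB m₀ _).2
    ⟨MpPsi.toRep (localSchrodinger (Fp L) (n' + n') T v) (sB (tensorEmbLoc L e dV hdV dW hdW eW e' dV' hdV' v k)) Φ, funext fun h => ?_⟩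
  exact (swSectionTensorLoc_mul_right L e dV hdV dW hdW eW e' dV' hdV' v sB m₀ Φ h k).symm

/-- the `ℂ`-span of the right translates of an element of `R_n(V′_v)` stays inside `R_n(V′_v)`. [cite: GanQiuTakeda2014, §5.4] -/
theorem span_rightTranslates_le_localSWImage {f : UnitaryGroup.localPi L (IsCMField.complexConj L) (n + n) (hermD L e dV hdV dW hdW) v → ℂ}
    (hf : f ∈ localSWImage L e dV hdV dW hdW eW e' dV' hdV' v sB m₀) :
    Submodule.span ℂ (Set.range fun k : UnitaryGroup.localPi L (IsCMField.complexConj L) (n + n) (hermD L e dV hdV dW hdW) v =>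
        fun h => f (h * k)) ≤ localSWImage L e dV hdV dW hdW eW e' dV' hdV' v sB m₀ := by
  refine Submodule.span_le.2 ?_
  rintro _ ⟨k, rfl⟩
  exact rightTranslate_mem_localSWImage L e dV hdV dW hdW eW e' dV' hdV' v sB m₀ hf k

/-! ## §4 Docking into `I_v(s, χ_v)` -/

/-- **`R_n(V′_v) ≤ I_v(s, χ_v)`** (★ `localDegPS` of the doubled datum) as soon as every Siegel–Weil section `F_Φ` is a local Siegel section of parameter `s`
for the character family `χ_v` and is smooth — both BY VALUE (for Kudla's datum and `s = (M₂ − n)∕2` they are the Siegel eigen-law ★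
`apply_zero_toRep_mul_localSplitting_eq_mul` and the smoothness of the local Weil representation). [cite: GanQiuTakeda2014, §5.4–5.5 Prop. 11]
[cite: KudlaRallis1994, §1] [cite: HarrisKudlaSweet1996, §1 (1.15)–(1.16)] -/
theorem localSWImage_le_localDegPS (χv : ∀ w : UnitaryGroup.PlacesOver L v, (w.1.adicCompletion L)ˣ →* ℂˣ) (s : ℂ)
    (hsec : ∀ Φ : SchwartzBruhat (Fin (n' + n') → v.adicCompletion (Fp L)),
      IsLocalSiegelSection (Fp L) L (IsCMField.complexConj L) (complexConj_imagUnit L) (imagUnit_ne_zero L) (imagUnit_mul_self L)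
        v n (gramR_isSymm L e dV hdV dW hdW) (hermD_eq_map_gramD L e dV hdV dW hdW) χv s
        (swSectionTensorLoc L e dV hdV dW hdW eW e' dV' hdV' v sB m₀ Φ))
    (hsm : ∀ Φ : SchwartzBruhat (Fin (n' + n') → v.adicCompletion (Fp L)),
      IsSmooth (Fp L) L (IsCMField.complexConj L) v n (swSectionTensorLoc L e dV hdV dW hdW eW e' dV' hdV' v sB m₀ Φ)) :
    haveI : Algebra.IsQuadraticExtension (Fp L) L := IsCMField.isQuadraticExtension L
    localSWImage L e dV hdV dW hdW eW e' dV' hdV' v sB m₀ ≤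
      localDegPS (Fp L) L (IsCMField.complexConj L) (complexConj_imagUnit L) (imagUnit_ne_zero L) (imagUnit_mul_self L)
        v n (gramR_isSymm L e dV hdV dW hdW) (hermD_eq_map_gramD L e dV hdV dW hdW) χv s := by
  rintro f ⟨Φ, rfl⟩
  exact ⟨hsec Φ, hsm Φ⟩

end Summit.HodgeConjecture.HodgeConjecture.Cruxes.HLiu418.K2LiuLocalSWImageDefs

end
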